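import Summits.ABC.ABC.Theses.DefiniteXi
import Summits.ABC.ABC.Theorems.DefiniteXiDefiniteRTControlPrime
import Summits.ABC.ABC.Theorems.DefiniteXiFreyModularity
import Summits.ABC.ABC.Theorems.DefiniteXiDefiniteRTControlPrimeSmulTransportDeg
import Summits.ABC.ABC.Theorems.DefiniteXiDefiniteRTControlPrimeValTransport
import Summits.ABC.ABC.Theorems.DefiniteXiDefiniteRTControlPrimeFreyScale
import Summits.ABC.ABC.Theorems.DefiniteXiDefiniteRTControlPrimeFreyLocal
import Summits.ABC.ABC.Theorems.IsogenyGlueCongruenceMazurKenkuBoundOfRadius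
import Literature.NumberTheory.EllipticCurves.TakahashiDegreeFormulaCoprimeProofs
import Literature.NumberTheory.EllipticCurves.PastenSpectralDegree
import Literature.NumberTheory.EllipticCurves.PastenHeightBounds
import Literature.NumberTheory.EllipticCurves.PastenHeightBoundsLemma68LocalProofs
import Literature.NumberTheory.EllipticCurves.PastenSpectralDegreeIsogenyBoundProofs
import Literature.NumberTheory.EllipticCurves.IsogenyDegreeLatticeIndexProofs
import Literature.NumberTheory.EllipticCurves.ModularCurveManinSemistableBridgeProofs
import Literature.NumberTheory.EllipticCurves.ModularDegreeMinimal
import Literature.NumberTheory.EllipticCurves.IsogenyVariableChangeProofs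
import Literature.NumberTheory.EllipticCurves.IsogenyCompProofs
import Literature.NumberTheory.EllipticCurves.IsogenyDualProofs
import Literature.NumberTheory.EllipticCurves.IsogenyIdProofs
import Literature.NumberTheory.EllipticCurves.RationalIsogenyDegreesProofs
import Literature.NumberTheory.Automorphic.ShimuraCurveRibetTakahashiComponentOrders
import Literature.NumberTheory.DiophantineGeometry.MinimalDiscriminantFactorizationProofs
import HarnessLib

/-!
# Stub ideas k2 (gen 5, family RESHAPE) — `stub_pastenLemma68 : PastenShimura2024_lemma_6_8`
(crux `DefiniteRTControlPrime`, stmt-ABC-11338, route `DefiniteXi`, skeleton `Lines/Sketch.lean`).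

**Gen-5 reshape: the ONE-ISOGENY PIVOT.**  The landed composition (p97354) and every earlier reshape
(k2-g4 class radius, k3-g5 `163²`) use TWO auxiliary curves — the lattice-optimal `(W₀, D₀)` for the
degree leg (`h163`) and the conductor-restricted Takahashi pivot `(W⋆, P⋆)` for the valuation leg
(`h68`) — and hence TWO isogenies of the class.  Here the degree leg is re-rooted at `W⋆` itself by
ONE new helper,

  **P1** `modularDegree_le_degree_mul`: an isogeny `ψ` from (the lattice curve of) a parametrised
  `(V, P)` to (the lattice curve of) a globally minimal parametrised `(W', D')` with the same newform
  gives `deg D'_min ≤ deg ψ · deg P`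

(push the datum `P` forward along `ψ`: rational multiplier `q` of `ψ` with `#ker(z ↦ qz) = deg ψ`
(`degree_eq_natCard_ker_mulQuotientMap_of_baseChange_eq_curve`), Manin constant `k = q·c_P ∈ ℤ` by the
tree's integrality (`hInt_of_pivot …`), `deg = #ker · δ` (`modularDegree_eq_card_ker_mul_of_eichlerShimuraMap`)
and `#ker(qc) = #ker(q)·#ker(c)` (P1a)).  Consequence (G₀, PROVED): at one coprime pair and odd
conductor prime `q`, ONE `ℚ`-isogeny `φ : E_(a,b) → W⋆` of degree `d` gives

  `deg D_min(E) ≤ 4 · d² · ξ(M; q) · v_q(Δ_min E)`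

(`φ` feeds H2 = the valuation leg; its dual, conjugated by the degree-one variable-change isogenies
to the lattice curves, feeds P1 = the degree leg; no `W₀`, no `h163`, no `h68`, no conductor facts).
So BOTH Pasten stubs collapse onto the single weakest leaf **L0** `FreyOptimalRadiusSubpoly`: the Frey
curve is `R_ε N^ε`-close to the `X₀(N)`-optimal curve of its class (quantified exactly as Takahashi's
minimality clause), `C(ε) = 4 R(ε/2)²`; fed by the rooted radius L1/L1ε (`FreyIsogenyRadius R`, all
earlier suppliers: `MazurKenkuRadius` stmt-ABC-15193 ↦ `R = 163`; k2-g3 `freyIsogenyRadius163 h44 h13 h5`;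
the Mazur-free programmes of k2-163/k1-68) with `C = 4R²` (gen-4 rooted glue: `4R⁴`).

All helper lemmas and glue theorems below are PROVED (no `sorry`); the verbatim stub is not touched
(verdict unchanged: `blocked-on stmt-ABC-15193`, see the STUB-IDEAS file).
-/

set_option linter.dupNamespace false

noncomputable section

open scoped Classical MatrixGroups ModularForm
open CongruenceSubgroup UpperHalfPlane
open WeierstrassCurve IsDedekindDomain NumberField
open Literature.NumberTheory.EllipticCurves Literature.NumberTheory.EllipticCurves.ModularForms
open Literature.NumberTheory.DiophantineGeometry
open Literature.NumberTheory.Automorphic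
open Summit.ABC.ABC.Theorems
open Summit.ABC.ABC.Theses.DefiniteXi

namespace Summit.ABC.ABC.Cruxes.DefiniteRTControlPrime.StubIdeas2G5

/-! ## 0. The leaves -/

/-- **L1.** Rooted radius of the Frey isogeny class at an odd conductor prime (verbatim the k2-g2…g4
`FreyIsogenyRadius`): every curve `ℚ`-isogenous to `E_(a,b)` is reached from it by a `ℚ`-isogeny of
degree `≤ R`. -/
def FreyIsogenyRadius (R : ℕ) : Prop :=
  ∀ (a b : ℤ), IsCoprime a b → a * b * (a + b) ≠ 0 → ∀ q : ℕ, q.Prime → q ≠ 2 →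
    q ∣ (freyCurve a b).conductorNorm ℤ →
    ∀ (W' : WeierstrassCurve ℚ) [W'.IsElliptic], (freyCurve a b).IsIsogenous W' →
      ∃ φ : Isogeny (freyCurve a b) W', φ.degree ≤ R

/-- **L1ε.** Sub-polynomial rooted radius: for every `ε > 0`, radius `≤ R_ε · N^ε` (`N` the conductor). -/
def FreyIsogenyRadiusSubpoly : Prop :=
  ∀ ε : ℝ, 0 < ε → ∃ R : ℝ, ∀ (a b : ℤ), IsCoprime a b → a * b * (a + b) ≠ 0 →
    ∀ q : ℕ, q.Prime → q ≠ 2 → q ∣ (freyCurve a b).conductorNorm ℤ →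
    ∀ (W' : WeierstrassCurve ℚ) [W'.IsElliptic], (freyCurve a b).IsIsogenous W' →
      ∃ φ : Isogeny (freyCurve a b) W',
        (φ.degree : ℝ) ≤ R * (((freyCurve a b).conductorNorm ℤ : ℕ) : ℝ) ^ ε

/-- **L0 — THE WEAKEST LEAF (one isogeny).** For every `ε > 0` there is `R` such that the Frey curve
of conductor `N` is joined to any `X₀(N)`-OPTIMAL curve `W⋆` of its class — a conductor-`N` curve
carrying a datum `P⋆` of minimal degree among all level-`N` data of conductor-`N` curves with the same
newform, verbatim Takahashi's minimality clause — by a `ℚ`-isogeny of degree `≤ R · N^ε`. -/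
def FreyOptimalRadiusSubpoly : Prop :=
  ∀ ε : ℝ, 0 < ε → ∃ R : ℝ, ∀ (a b : ℤ), IsCoprime a b → a * b * (a + b) ≠ 0 →
    ∀ (N : ℕ) [NeZero N], (freyCurve a b).conductorNorm ℤ = N →
    ∀ q : ℕ, q.Prime → q ≠ 2 → q ∣ N →
    ∀ (W' : WeierstrassCurve ℚ) [W'.IsElliptic] (P' : ModularParametrizationData W' N),
      W'.conductorNorm ℤ = N →
      (∀ (W'' : WeierstrassCurve ℚ) [W''.IsElliptic], W''.conductorNorm ℤ = N →
          ∀ P'' : ModularParametrizationData W'' N, P''.f = P'.f →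
            P'.modularDegree ≤ P''.modularDegree) →
      (freyCurve a b).IsIsogenous W' →
        ∃ φ : Isogeny (freyCurve a b) W', (φ.degree : ℝ) ≤ R * (N : ℝ) ^ ε

/-! ## 1. Plumbing: degrees of composites and duals, kernels of `z ↦ cz` multiply -/

/-- R0a (k2-g4, PROVED): degree of a composite. [folklore] -/
theorem degree_comp {W W' W'' : WeierstrassCurve ℚ} [W.IsElliptic] [W'.IsElliptic]
    (ψ : Isogeny W' W'') (φ : Isogeny W W') : (ψ.comp φ).degree = ψ.degree * φ.degree := by
  change Nat.card (ψ.toAddMonoidHom.comp φ.toAddMonoidHom).ker = _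
  rw [AddMonoidHom.natCard_ker_comp_of_surjective _ _ φ.surjective]
  rfl

/-- R0c: the dual isogeny has the same degree. [cite: SilvermanAEC2009, Thm. III.6.1(a), III.6.2(e)] -/
theorem exists_dual_degree_eq {W W' : WeierstrassCurve ℚ} [W.IsElliptic] [W'.IsElliptic]
    (φ : Isogeny W W') : ∃ ψ : Isogeny W' W, ψ.degree = φ.degree := by
  obtain ⟨ψ, hψ⟩ := φ.exists_dual_of_isElliptic
  exact ⟨ψ, Isogeny_degree_eq_of_comp_eq_degree_zsmul φ ψ hψ⟩

/-- **P1a.** Kernels multiply along `ℂ/Λ₁ →(c) ℂ/Λ₂ →(d) ℂ/Λ₃`: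
`#ker(z ↦ dcz) = #ker(z ↦ dz) · #ker(z ↦ cz)` (`c ≠ 0`, so the first map is onto). [folklore] -/
theorem natCard_ker_mulQuotientMap_mul {Λ₁ Λ₂ Λ₃ : AddSubgroup ℂ} {c d : ℂ} (hc0 : c ≠ 0)
    (hc : ∀ z ∈ Λ₁, c * z ∈ Λ₂) (hd : ∀ z ∈ Λ₂, d * z ∈ Λ₃)
    (hdc : ∀ z ∈ Λ₁, d * c * z ∈ Λ₃) :
    Nat.card (mulQuotientMap Λ₁ Λ₃ (d * c) hdc).ker =
      Nat.card (mulQuotientMap Λ₂ Λ₃ d hd).ker * Nat.card (mulQuotientMap Λ₁ Λ₂ c hc).ker := by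
  have hcomp : (mulQuotientMap Λ₂ Λ₃ d hd).comp (mulQuotientMap Λ₁ Λ₂ c hc) =
      mulQuotientMap Λ₁ Λ₃ (d * c) hdc := by
    refine AddMonoidHom.ext fun P => ?_
    induction P using QuotientAddGroup.induction_on with
    | H z =>
      rw [AddMonoidHom.comp_apply, mulQuotientMap_mk, mulQuotientMap_mk, mulQuotientMap_mk,
        mul_assoc]
  rw [← hcomp, AddMonoidHom.natCard_ker_comp_of_surjective _ _ (mulQuotientMap_surjective hc0)]

/-- Transport of `#ker(z ↦ cz)` along equalities of the lattices AND of the multiplier. [folklore] -/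
theorem natCard_ker_mulQuotientMap_congr' {Λ₁ Λ₁' Λ₂ Λ₂' : AddSubgroup ℂ} (h₁ : Λ₁ = Λ₁')
    (h₂ : Λ₂ = Λ₂') {c c' : ℂ} (hcc : c = c') (hc : ∀ z ∈ Λ₁, c * z ∈ Λ₂)
    (hc' : ∀ z ∈ Λ₁', c' * z ∈ Λ₂') :
    Nat.card (mulQuotientMap Λ₁ Λ₂ c hc).ker = Nat.card (mulQuotientMap Λ₁' Λ₂' c' hc').ker := by
  subst h₁ h₂ hcc
  rfl

/-! ## 2. P1 — push a datum forward along ONE isogeny, keeping track of the degree -/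

/-- **P1 (the gen-5 helper).**  Let `(V, P)` and `(W', D')` be parametrised at level `N` with the same
newform, `W'` globally minimal and `D'` of minimal degree among the data of `W'`; let `ψ` be a
`ℚ`-isogeny from a model of `V` onto a model of `W'` whose base changes are the lattice curves of the
two period pairs (the short models, `shortModel_baseChange_eq_curve`).  Then `deg D' ≤ deg ψ · deg P`:
the parametrisation `ψ ∘ φ_P` of `W'` has Manin multiplier `k = q · c_P` (`q` the rational multiplier
of `ψ`), integral by Edixhoven's integrality in the tree's form `hInt_of_pivot`, and degree
`#ker(z ↦ kz) · δ = #ker(q) · #ker(c_P) · δ = deg ψ · deg P`.  (Folklore: `deg φ_{E'} ∣ deg ψ · deg φ_E`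
for `ψ : E → E'`; Cremona, *Algorithms* §2.10.)
[cite: SilvermanAEC2009, Thm. VI.4.1(b)] [cite: EdixhovenManin1991, Prop. 2] -/
theorem modularDegree_le_degree_mul {N : ℕ} [NeZero N] {V W' : WeierstrassCurve ℚ}
    [V.IsElliptic] [W'.IsElliptic] [W'.IsGloballyMinimal]
    (P : ModularParametrizationData V N) (D' : ModularParametrizationData W' N) (hf : D'.f = P.f)
    (hmin' : ∀ D'' : ModularParametrizationData W' N, D'.modularDegree ≤ D''.modularDegree)
    {Vs Ws : WeierstrassCurve ℚ} [Vs.IsElliptic] [Ws.IsElliptic] (ψ : Isogeny Vs Ws)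
    (hVs : Vs.baseChange ℂ = P.L.curve) (hWs : Ws.baseChange ℂ = D'.L.curve) :
    D'.modularDegree ≤ ψ.degree * P.modularDegree := by
  have hInt : ∀ {N : ℕ} [NeZero N] {W' : WeierstrassCurve ℚ} [W'.IsElliptic] [W'.IsGloballyMinimal]
      (D' : ModularParametrizationData W' N) (q : ℚ),
      (∀ z ∈ periodLattice D'.f, (q : ℂ) * z ∈ D'.L.lattice) → ∃ k : ℤ, (k : ℚ) = q :=
    hInt_of_pivot integral_neronScaling_of_isGloballyMinimal_holds edixhovenIntegrality_proof
  -- the rational multiplier `q` of `ψ`, `#ker(z ↦ qz : ℂ/Λ_V → ℂ/Λ_{W'}) = deg ψ`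
  obtain ⟨q, hq0, hq, hdegq⟩ :=
    degree_eq_natCard_ker_mulQuotientMap_of_baseChange_eq_curve ψ hVs hWs
  -- `k := q · c_P`, `k Λ_f ⊆ Λ_{W'}`, `k ∈ ℤ`
  have hPc : ∀ z ∈ periodLattice D'.f, (P.c : ℂ) * z ∈ P.L.lattice := fun z hz ↦
    P.smul_periodLattice_le z (hf ▸ hz)
  have hk' : ∀ z ∈ periodLattice D'.f, ((q * P.c : ℚ) : ℂ) * z ∈ D'.L.lattice := fun z hz ↦ by
    have h := hq _ (hPc z hz)
    rw [← mul_assoc] at h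
    push_cast
    exact h
  obtain ⟨k, hkq⟩ := hInt D' (q * P.c) hk'
  have hkC : (k : ℂ) = (q : ℂ) * (P.c : ℂ) := by
    have h := congrArg (fun x : ℚ => (x : ℂ)) hkq
    push_cast at h
    exact h
  have hk : ∀ z ∈ periodLattice D'.f, (k : ℂ) * z ∈ D'.L.lattice := fun z hz ↦ by
    have h := hk' z hz
    push_cast at h
    rwa [hkC]
  have hc : (P.c : ℚ) ≠ 0 := by exact_mod_cast P.maninConstant_ne_zero_holds
  have hk0 : k ≠ 0 := by
    have h : (k : ℚ) ≠ 0 := by rw [hkq]; exact mul_ne_zero hq0 hc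
    exact_mod_cast h
  -- the common degree `δ` of the Eichler–Shimura map of `f`
  haveI := discreteTopology_periodLattice_of_mul_mem D'.f D'.cast_c_ne_zero D'.smul_periodLattice_le
  obtain ⟨δ, hδ, hfinδ⟩ := exists_degree_eichlerShimuraMap' (N := N) D'.isNewformOf.1.ne_zero
  -- the datum of `W'` with Manin constant `k`, and the two degree formulas
  obtain ⟨Dk, hDkf, hDkL, -, hDkc⟩ := D'.exists_datum_c_eq hk0 hk
  obtain ⟨-, hdegK⟩ := Dk.modularDegree_eq_card_ker_mul_of_eichlerShimuraMap hDkf hδ hfinδ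
  obtain ⟨-, hdegP⟩ := P.modularDegree_eq_card_ker_mul_of_eichlerShimuraMap hf.symm hδ hfinδ
  -- `#ker(k) = #ker(q) · #ker(c_P) = deg ψ · #ker(c_P)`
  have hqc : ∀ z ∈ (periodLattice P.f : AddSubgroup ℂ), (q : ℂ) * (P.c : ℂ) * z ∈
      D'.L.lattice.toAddSubgroup := fun z hz ↦ by
    rw [mul_assoc]
    exact hq _ (P.smul_periodLattice_le z hz)
  have hmul : Nat.card Dk.isogenyMap.ker = ψ.degree * Nat.card P.isogenyMap.ker := by
    have h1 : Nat.card Dk.isogenyMap.ker =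
        Nat.card (mulQuotientMap (periodLattice P.f) D'.L.lattice.toAddSubgroup
          ((q : ℂ) * (P.c : ℂ)) hqc).ker :=
      natCard_ker_mulQuotientMap_congr' (by rw [hDkf, hf]) (by rw [hDkL]) (by rw [hDkc, hkC]) _ _
    have hq'' : ∀ z ∈ P.L.lattice.toAddSubgroup, (q : ℂ) * z ∈ D'.L.lattice.toAddSubgroup :=
      fun z hz => hq z hz
    rw [h1, natCard_ker_mulQuotientMap_mul (Λ₂ := P.L.lattice.toAddSubgroup) P.cast_c_ne_zero
      P.smul_periodLattice_le hq'' hqc, ← hdegq]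
    rfl
  calc D'.modularDegree ≤ Dk.modularDegree := hmin' Dk
    _ = Nat.card Dk.isogenyMap.ker * δ := hdegK
    _ = ψ.degree * (Nat.card P.isogenyMap.ker * δ) := by rw [hmul, mul_assoc]
    _ = ψ.degree * P.modularDegree := by rw [← hdegP]

/-! ## 3. H2 — the valuation leg from ONE isogeny (k2-g4 H2a/H2, PROVED, Mazur-free) -/

/-- **H2a**: along a `ℚ`-isogeny of degree `d`, `c_v` moves by a factor `≤ d` at a multiplicative
place. [cite: PastenShimura2024, §6.4 (p. 22)] -/
theorem ordMinimalDiscriminant_le_degree_mul {W W' : WeierstrassCurve ℚ} [W.IsElliptic]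
    [W'.IsElliptic] (ψ : Isogeny W W') (v : HeightOneSpectrum ℤ)
    (hv : W.HasMultiplicativeReductionAt v) :
    W'.ordMinimalDiscriminant v ≤ ψ.degree * W.ordMinimalDiscriminant v := by
  obtain ⟨ψ', hcyc, hdvd⟩ := ψ.exists_isCyclic_degree_dvd
  have hv' : W'.HasMultiplicativeReductionAt v :=
    hasMultiplicativeReductionAt_of_isIsogenous ⟨ψ⟩ v hv
  obtain ⟨m, n, hm, hn, hmn, heq⟩ :=
    exists_ordMinimalDiscriminant_mul_eq_mul_of_isCyclic ψ'.degree ψ' hcyc rfl v hv hv'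
  have hle : m * n ≤ ψ.degree :=
    (Nat.le_of_dvd ψ'.degree_pos hmn).trans (Nat.le_of_dvd ψ.degree_pos hdvd)
  have hn' : n ≤ ψ.degree := (Nat.le_mul_of_pos_left n hm).trans hle
  calc W'.ordMinimalDiscriminant v
      ≤ W'.ordMinimalDiscriminant v * m := Nat.le_mul_of_pos_right _ hm
    _ = W.ordMinimalDiscriminant v * n := heq.symm
    _ ≤ W.ordMinimalDiscriminant v * ψ.degree := Nat.mul_le_mul_left _ hn'
    _ = ψ.degree * W.ordMinimalDiscriminant v := Nat.mul_comm _ _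

/-- **H2**: `v_q(Δ_min W') ≤ d · v_q(Δ_min E_(a,b))` from ONE `ℚ`-isogeny `E_(a,b) → W'` of degree
`≤ d`, `q` an odd conductor prime. -/
theorem factorization_le_mul_of_isogeny {a b : ℤ} (hab : IsCoprime a b) (h0 : a * b * (a + b) ≠ 0)
    {q : ℕ} (hq : q.Prime) (hq2 : q ≠ 2) (hqN : q ∣ (freyCurve a b).conductorNorm ℤ)
    {W' : WeierstrassCurve ℚ} [W'.IsElliptic] {B : ℕ} (φ : Isogeny (freyCurve a b) W')
    (hφ : φ.degree ≤ B) :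
    (W'.minimalDiscriminantNorm ℤ).factorization q ≤
      B * ((freyCurve a b).minimalDiscriminantNorm ℤ).factorization q := by
  haveI := isElliptic_freyCurve h0
  obtain ⟨v, hv⟩ :
      ∃ v : HeightOneSpectrum ℤ, Rat.HeightOneSpectrum.natGenerator v = q :=
    ⟨(Rat.HeightOneSpectrum.primesEquiv (R := ℤ)).symm ⟨q, hq⟩,
      Rat.natGenerator_primesEquiv_symm ⟨q, hq⟩⟩
  have hdvd : (q : ℤ) ∣ a * b * (a + b) := dvd_of_dvd_conductorNorm_freyCurve hab h0 hq hq2 hqN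
  have hmult : (freyCurve a b).HasMultiplicativeReductionAt v :=
    hasMultiplicativeReductionAt_freyCurve_of_ne_two hab h0 v (hv ▸ hq2) (hv ▸ hdvd)
  have h1 := factorization_minimalDiscriminantNorm_holds (freyCurve a b) v
  have h2 := factorization_minimalDiscriminantNorm_holds W' v
  rw [hv] at h1 h2
  rw [h1, h2]
  exact (ordMinimalDiscriminant_le_degree_mul φ v hmult).trans (Nat.mul_le_mul_right _ hφ)

/-! ## 4. Suppliers of the leaves -/

/-- The route item `MazurKenkuRadius` (stmt-ABC-15193) ⟹ L1 with `R = 163`. -/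
theorem freyIsogenyRadius_of_mazurKenkuRadius (h : MazurKenkuRadius) : FreyIsogenyRadius 163 := by
  intro a b hab h0 q hq hq2 hqN W' _ hiso
  haveI := isElliptic_freyCurve h0
  exact h (freyCurve a b) W' hiso

/-- L1 ⟹ L1ε (the `N^ε` is idle: `N ≥ 1`). -/
theorem freyIsogenyRadiusSubpoly_of_radius {R : ℕ} (hR : FreyIsogenyRadius R) :
    FreyIsogenyRadiusSubpoly := by
  intro ε hε
  refine ⟨R, fun a b hab h0 q hq hq2 hqN W' _ hiso => ?_⟩
  obtain ⟨φ, hφ⟩ := hR a b hab h0 q hq hq2 hqN W' hiso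
  haveI := isElliptic_freyCurve h0
  refine ⟨φ, ?_⟩
  have hN1 : (1 : ℝ) ≤ (((freyCurve a b).conductorNorm ℤ : ℕ) : ℝ) := by
    exact_mod_cast (freyCurve a b).conductorNorm_pos_holds
  have hrpow : (1 : ℝ) ≤ (((freyCurve a b).conductorNorm ℤ : ℕ) : ℝ) ^ ε :=
    Real.one_le_rpow hN1 hε.le
  have hR0 : (0 : ℝ) ≤ (R : ℝ) := Nat.cast_nonneg R
  calc (φ.degree : ℝ) ≤ (R : ℝ) := by exact_mod_cast hφ
    _ = (R : ℝ) * 1 := (mul_one _).symm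
    _ ≤ (R : ℝ) * (((freyCurve a b).conductorNorm ℤ : ℕ) : ℝ) ^ ε :=
        mul_le_mul_of_nonneg_left hrpow hR0

/-- L1ε ⟹ L0 (forget that `W⋆` is optimal). -/
theorem freyOptimalRadiusSubpoly_of_rooted (hR : FreyIsogenyRadiusSubpoly) :
    FreyOptimalRadiusSubpoly := by
  intro ε hε
  obtain ⟨R, hR⟩ := hR ε hε
  refine ⟨R, fun a b hab h0 N _ hN q hq hq2 hqN W' _ P' _ _ hiso => ?_⟩
  have hqN' : q ∣ (freyCurve a b).conductorNorm ℤ := by rw [hN]; exact hqN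
  obtain ⟨φ, hφ⟩ := hR a b hab h0 q hq hq2 hqN' W' hiso
  refine ⟨φ, ?_⟩
  rwa [hN] at hφ

end Summit.ABC.ABC.Cruxes.DefiniteRTControlPrime.StubIdeas2G5

/-! ## 5. The re-glue: the crux from Takahashi 2.3 and ONE isogeny to the optimal curve -/

namespace Summit.ABC.ABC.Theorems.DefiniteRTControlPrime

open Summit.ABC.ABC.Theses.DefiniteXi
open Summit.ABC.ABC.Cruxes.DefiniteRTControlPrime.StubIdeas2G5
open Literature.NumberTheory.EllipticCurves Literature.NumberTheory.EllipticCurves.ModularForms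
open Literature.NumberTheory.Automorphic
open WeierstrassCurve

/-- **G₀ (pointwise core, in `ℕ`; the ONE-ISOGENY PIVOT).**  At one coprime pair, odd conductor prime
`q` (`N = M q`) and minimal datum `D` of the Frey MODEL: if the Frey curve is joined to the Takahashi
pivot `W⋆` (`exists_conductorMinimal`, p97354) by ONE `ℚ`-isogeny `φ` of degree `≤ B`, then
`deg D ≤ 4 B² · ξ(M; q) · v_q(Δ_min E)`.  Chain: `deg D ≤ 4 deg D₁` (model transport, landed stubs);
`deg D₁ ≤ deg ψ · deg P⋆ = deg φ · deg P⋆` (P1 along `ψ` = dual of `φ` conjugated to the lattice curves);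
`deg P⋆ ≤ ξ · v_q(Δ_min W⋆)` (Takahashi); `v_q(Δ_min W⋆) ≤ deg φ · v_q(Δ_min E)` (H2 along `φ`).
No `W₀`, no `h163`, no `h68`. [cite: Takahashi2001, Thm. 2.3 (p. 79)] [cite: PastenShimura2024, §3 p. 13, §6.4] -/
theorem deg_le_of_optimalIsogenyAt (hT : takahashi2001_thm_2_3_of_coprime) {a b : ℤ}
    (hab : IsCoprime a b) (h0 : a * b * (a + b) ≠ 0) {M q : ℕ} [NeZero (M * q)]
    (hN : (freyCurve a b).conductorNorm ℤ = M * q) (hq : q.Prime) (hq2 : q ≠ 2) {B : ℕ}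
    (hOpt : ∀ (W' : WeierstrassCurve ℚ) [W'.IsElliptic]
      (P' : ModularParametrizationData W' (M * q)), W'.conductorNorm ℤ = M * q →
      (∀ (W'' : WeierstrassCurve ℚ) [W''.IsElliptic], W''.conductorNorm ℤ = M * q →
          ∀ P'' : ModularParametrizationData W'' (M * q), P''.f = P'.f →
            P'.modularDegree ≤ P''.modularDegree) →
      (freyCurve a b).IsIsogenous W' → ∃ φ : Isogeny (freyCurve a b) W', φ.degree ≤ B)
    (D : ModularParametrizationData (freyCurve a b) (M * q))
    (hDmin : ∀ D' : ModularParametrizationData (freyCurve a b) (M * q), D.deg ≤ D'.deg) :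
    D.deg ≤ 4 * B * B * (brandtXi M q (fun n => (freyCurve a b).LFunction n) *
      ((freyCurve a b).minimalDiscriminantNorm ℤ).factorization q) := by
  haveI := isElliptic_freyCurve h0
  have hdiv : M * q / q = M := Nat.mul_div_cancel M hq.pos
  have hqN' : q ∣ (freyCurve a b).conductorNorm ℤ := by rw [hN]; exact Dvd.intro_left M rfl
  -- `gcd(M, q) = 1`
  have hcop : M.Coprime q := by
    have h := stub_freyLocal a b hab h0 q hq hq2 hqN'
    rwa [hN, hdiv] at h
  -- a global minimal model `W_m = C • E`, its data, a minimal one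
  obtain ⟨C, hC⟩ := hasGlobalMinimalModel_rat_holds (freyCurve a b)
  haveI := hC
  have hNm : (C • freyCurve a b).conductorNorm ℤ = M * q := by rw [conductorNorm_smul_rat, hN]
  have hne : Nonempty (ModularParametrizationData (C • freyCurve a b) (M * q)) :=
    (Summit.ABC.ABC.Theorems.nonempty_modularParametrizationData_smul_iff C).mpr ⟨D⟩
  obtain ⟨D₁, -, hD₁min⟩ := exists_minimal_datum hne
  -- the Takahashi pivot `(W⋆, P⋆)` — the ONLY auxiliary curve
  obtain ⟨Ws, hWs, Ps, hNs, hfs, hPsmin⟩ := exists_conductorMinimal D₁ hNm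
  haveI := hWs
  -- Takahashi at `(W⋆, P⋆)`
  have hTak : Ps.modularDegree ≤ brandtXi M q (fun n => Ws.LFunction n) *
      (Ws.minimalDiscriminantNorm ℤ).factorization q :=
    takahashi2001_thm_2_3_of_coprime.modularDegree_le_brandtXi_mul hT Ws M q hq hcop
      hNs Ps hPsmin
  -- `a(W⋆) = a(f₁) = a(W_m) = a(E)`
  have hL : (fun n => Ws.LFunction n) = fun n => (freyCurve a b).LFunction n := by
    funext n
    have h1 := Ps.isNewformOf.2 n
    have h2 := D₁.isNewformOf.2 n
    rw [hfs] at h1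
    rw [h1, LFunction_smul] at h2
    exact_mod_cast h2
  rw [hL] at hTak
  -- THE ONE ISOGENY `φ : E → W⋆`, `deg φ ≤ B`
  have hiso : (freyCurve a b).IsIsogenous Ws :=
    (isIsogenous_smul (freyCurve a b) C).trans' (isIsogenous_of_f_eq D₁ Ps hfs)
  obtain ⟨φ, hφ⟩ := hOpt Ws Ps hNs hPsmin hiso
  -- (T_val) first use of `φ`: H2
  have hval : (Ws.minimalDiscriminantNorm ℤ).factorization q ≤
      B * ((freyCurve a b).minimalDiscriminantNorm ℤ).factorization q :=
    factorization_le_mul_of_isogeny hab h0 hq hq2 hqN' φ hφ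
  -- (T_deg) second use of `φ`: its dual, conjugated to the lattice (short) models, through P1
  have hEs : ((⟨1, -Ws.b₂ / 12, -Ws.a₁ / 2, Ws.a₁ * Ws.b₂ / 24 - Ws.a₃ / 2⟩ : VariableChange ℚ)
      • Ws).baseChange ℂ = Ps.L.curve :=
    shortModel_baseChange_eq_curve Ws Ps.isNeronLattice
  have hEm : ((⟨1, -(C • freyCurve a b).b₂ / 12, -(C • freyCurve a b).a₁ / 2,
      (C • freyCurve a b).a₁ * (C • freyCurve a b).b₂ / 24 - (C • freyCurve a b).a₃ / 2⟩ :
        VariableChange ℚ) • (C • freyCurve a b)).baseChange ℂ = D₁.L.curve :=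
    shortModel_baseChange_eq_curve (C • freyCurve a b) D₁.isNeronLattice
  set Cs : VariableChange ℚ := ⟨1, -Ws.b₂ / 12, -Ws.a₁ / 2, Ws.a₁ * Ws.b₂ / 24 - Ws.a₃ / 2⟩
    with hCs
  set C' : VariableChange ℚ := ⟨1, -(C • freyCurve a b).b₂ / 12, -(C • freyCurve a b).a₁ / 2,
      (C • freyCurve a b).a₁ * (C • freyCurve a b).b₂ / 24 - (C • freyCurve a b).a₃ / 2⟩ with hC'
  obtain ⟨φd, hφd⟩ := exists_dual_degree_eq ((VariableChange.toIsogeny Ws Cs).comp φ)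
  obtain ⟨ψ, hψ⟩ : ∃ ψ : Isogeny (Cs • Ws) (C' • (C • freyCurve a b)), ψ.degree = φ.degree :=
    ⟨((VariableChange.toIsogeny (C • freyCurve a b) C').comp
        (VariableChange.toIsogeny (freyCurve a b) C)).comp φd, by
      rw [degree_comp, degree_comp, hφd, degree_comp, VariableChange.degree_toIsogeny,
        VariableChange.degree_toIsogeny, VariableChange.degree_toIsogeny]
      ring⟩
  have hdeg₁ : D₁.modularDegree ≤ B * Ps.modularDegree := by
    have h := modularDegree_le_degree_mul Ps D₁ hfs.symm hD₁min ψ hEs hEm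
    rw [hψ] at h
    exact h.trans (Nat.mul_le_mul_right _ hφ)
  -- (T_model) back to the Frey model
  obtain ⟨D₁', -, hdeg₁'⟩ := stub_smulTransportDeg C D₁
  have hscale : (C.u : ℚ).num.natAbs ≤ 2 := stub_freyScale a b hab h0 C hC
  have hD : D.deg ≤ 4 * D₁.modularDegree := by
    calc D.deg ≤ D₁'.deg := hDmin D₁'
      _ = (C.u : ℚ).num.natAbs ^ 2 * D₁.deg := hdeg₁'
      _ ≤ 2 ^ 2 * D₁.deg := Nat.mul_le_mul_right _ (Nat.pow_le_pow_left hscale 2)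
      _ = 4 * D₁.modularDegree := by norm_num [ModularParametrizationData.modularDegree]
  -- the chain in `ℕ`
  set ξ : ℕ := brandtXi M q (fun n => (freyCurve a b).LFunction n) with hξ
  set v : ℕ := ((freyCurve a b).minimalDiscriminantNorm ℤ).factorization q with hv
  calc D.deg ≤ 4 * D₁.modularDegree := hD
    _ ≤ 4 * (B * Ps.modularDegree) := Nat.mul_le_mul_left _ hdeg₁
    _ ≤ 4 * (B * (ξ * (Ws.minimalDiscriminantNorm ℤ).factorization q)) :=
        Nat.mul_le_mul_left _ (Nat.mul_le_mul_left _ hTak)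
    _ ≤ 4 * (B * (ξ * (B * v))) :=
        Nat.mul_le_mul_left _ (Nat.mul_le_mul_left _ (Nat.mul_le_mul_left _ hval))
    _ = 4 * B * B * (ξ * v) := by ring

/-- **Gε — `DefiniteRTControlPrime` from Takahashi 2.3 and the weakest leaf L0**, `C(ε) = 4 R(ε/2)²`:
with `B := ⌊R N^(ε/2)⌋₊` in G₀, `deg D ≤ 4 B² ξ v ≤ 4 R² N^ε ξ v` — the crux's `N^ε` is load-bearing. -/
theorem definiteRTControlPrime_of_optimalRadiusSubpoly (hT : takahashi2001_thm_2_3_of_coprime)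
    (hRad : FreyOptimalRadiusSubpoly) : DefiniteRTControlPrime := by
  intro ε hε
  obtain ⟨R, hR⟩ := hRad (ε / 2) (half_pos hε)
  refine ⟨4 * (max R 0) ^ 2, ?_⟩
  intro a b hab h0 N _ hN q hq hq2 hqN D hDmin
  have hRN := hR a b hab h0 N hN q hq hq2 hqN
  -- `N = M q`
  obtain ⟨M, hM⟩ := hqN
  rw [mul_comm] at hM
  subst hM
  have hdiv : M * q / q = M := Nat.mul_div_cancel M hq.pos
  rw [hdiv]
  set Nr : ℝ := ((M * q : ℕ) : ℝ) with hNr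
  have hNr0 : (0 : ℝ) ≤ Nr := by positivity
  have hR0 : (0 : ℝ) ≤ max R 0 := le_max_right _ _
  have hpow0 : (0 : ℝ) ≤ Nr ^ (ε / 2) := Real.rpow_nonneg hNr0 _
  -- the integer radius at this `N`
  set B : ℕ := ⌊max R 0 * Nr ^ (ε / 2)⌋₊ with hB
  have hOptB : ∀ (W' : WeierstrassCurve ℚ) [W'.IsElliptic]
      (P' : ModularParametrizationData W' (M * q)), W'.conductorNorm ℤ = M * q →
      (∀ (W'' : WeierstrassCurve ℚ) [W''.IsElliptic], W''.conductorNorm ℤ = M * q →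
          ∀ P'' : ModularParametrizationData W'' (M * q), P''.f = P'.f →
            P'.modularDegree ≤ P''.modularDegree) →
      (freyCurve a b).IsIsogenous W' → ∃ φ : Isogeny (freyCurve a b) W', φ.degree ≤ B := by
    intro W' _ P' hNW' hmin' hiso
    obtain ⟨φ, hφ⟩ := hRN W' P' hNW' hmin' hiso
    refine ⟨φ, Nat.le_floor ?_⟩
    calc (φ.degree : ℝ) ≤ R * Nr ^ (ε / 2) := hφ
      _ ≤ max R 0 * Nr ^ (ε / 2) := mul_le_mul_of_nonneg_right (le_max_left _ _) hpow0
  have hchain := deg_le_of_optimalIsogenyAt hT hab h0 hN hq hq2 hOptB D hDmin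
  set ξ : ℕ := brandtXi M q (fun n => (freyCurve a b).LFunction n) with hξ
  set v : ℕ := ((freyCurve a b).minimalDiscriminantNorm ℤ).factorization q with hv
  have hcast : (D.deg : ℝ) ≤ 4 * (B : ℝ) * (B : ℝ) * ((ξ : ℝ) * (v : ℝ)) := by
    exact_mod_cast hchain
  have hξv : (0 : ℝ) ≤ (ξ : ℝ) * (v : ℝ) := by positivity
  have hBle : (B : ℝ) ≤ max R 0 * Nr ^ (ε / 2) := Nat.floor_le (mul_nonneg hR0 hpow0)
  have hB0 : (0 : ℝ) ≤ (B : ℝ) := Nat.cast_nonneg _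
  have hsq : Nr ^ (ε / 2) * Nr ^ (ε / 2) = Nr ^ ε := by
    rw [← Real.rpow_add' hNr0 (by linarith)]
    ring_nf
  calc (D.deg : ℝ) ≤ 4 * (B : ℝ) * (B : ℝ) * ((ξ : ℝ) * (v : ℝ)) := hcast
    _ ≤ 4 * (max R 0 * Nr ^ (ε / 2)) * (max R 0 * Nr ^ (ε / 2)) * ((ξ : ℝ) * (v : ℝ)) := by
        gcongr
    _ = 4 * (max R 0) ^ 2 * (Nr ^ (ε / 2) * Nr ^ (ε / 2)) * ((ξ : ℝ) * (v : ℝ)) := by ring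
    _ = 4 * (max R 0) ^ 2 * Nr ^ ε * ((ξ : ℝ) * (v : ℝ)) := by rw [hsq]

/-- **G — the crux from Takahashi 2.3 and a ROOTED radius `R`, `C = 4 R²`** (gen-4 rooted glue: `4 R⁴`). -/
theorem definiteRTControlPrime_of_freyIsogenyRadius (hT : takahashi2001_thm_2_3_of_coprime) {R : ℕ}
    (hR : FreyIsogenyRadius R) : DefiniteRTControlPrime := by
  intro ε hε
  refine ⟨((4 * R * R : ℕ) : ℝ), ?_⟩
  intro a b hab h0 N _ hN q hq hq2 hqN D hDmin
  -- `N = M q`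
  obtain ⟨M, hM⟩ := hqN
  rw [mul_comm] at hM
  subst hM
  have hdiv : M * q / q = M := Nat.mul_div_cancel M hq.pos
  rw [hdiv]
  have hqN' : q ∣ (freyCurve a b).conductorNorm ℤ := by rw [hN]; exact Dvd.intro_left M rfl
  have hchain := deg_le_of_optimalIsogenyAt hT hab h0 hN hq hq2
    (fun W' _ P' _ _ hiso => hR a b hab h0 q hq hq2 hqN' W' hiso) D hDmin
  set ξ : ℕ := brandtXi M q (fun n => (freyCurve a b).LFunction n) with hξ
  set v : ℕ := ((freyCurve a b).minimalDiscriminantNorm ℤ).factorization q with hv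
  -- to `ℝ`, inserting the idle `N^ε ≥ 1`
  have hN1 : (1 : ℝ) ≤ ((M * q : ℕ) : ℝ) := by
    exact_mod_cast Nat.one_le_iff_ne_zero.mpr (NeZero.ne (M * q))
  have hrpow : (1 : ℝ) ≤ ((M * q : ℕ) : ℝ) ^ ε := Real.one_le_rpow hN1 hε.le
  have hcast : (D.deg : ℝ) ≤ ((4 * R * R : ℕ) : ℝ) * ((ξ : ℝ) * (v : ℝ)) := by
    exact_mod_cast hchain
  have hξv : (0 : ℝ) ≤ (ξ : ℝ) * (v : ℝ) := by positivity
  calc (D.deg : ℝ) ≤ ((4 * R * R : ℕ) : ℝ) * ((ξ : ℝ) * (v : ℝ)) := hcast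
    _ = ((4 * R * R : ℕ) : ℝ) * 1 * ((ξ : ℝ) * (v : ℝ)) := by ring
    _ ≤ ((4 * R * R : ℕ) : ℝ) * ((M * q : ℕ) : ℝ) ^ ε * ((ξ : ℝ) * (v : ℝ)) := by gcongr

/-- **Gε ∘ (L1ε ⟹ L0).** The crux from Takahashi 2.3 and a sub-polynomial ROOTED radius. -/
theorem definiteRTControlPrime_of_freyIsogenyRadiusSubpoly (hT : takahashi2001_thm_2_3_of_coprime)
    (hR : FreyIsogenyRadiusSubpoly) : DefiniteRTControlPrime :=
  definiteRTControlPrime_of_optimalRadiusSubpoly hT (freyOptimalRadiusSubpoly_of_rooted hR)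

/-- **G ∘ S.** The crux from Takahashi 2.3 and the route item `MazurKenkuRadius` (stmt-ABC-15193) ALONE
(`C = 4·163²`, same constant as p97354 but with neither Pasten fact). -/
theorem definiteRTControlPrime_of_mazurKenkuRadius_oneLeg (hT : takahashi2001_thm_2_3_of_coprime)
    (hR : MazurKenkuRadius) : DefiniteRTControlPrime :=
  definiteRTControlPrime_of_freyIsogenyRadius hT (freyIsogenyRadius_of_mazurKenkuRadius hR)

end Summit.ABC.ABC.Theorems.DefiniteRTControlPrime

end
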